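import Summits.Ventures.PercRepro.Night2NonFatColoop

/-!
# night-2: the NON-FAT case of (FAIR) — the coloop bound with the true face weight (gen 37)

`faceSum_insert_le_choose` bounds every member face of a coloop target by `phiFace ≤ 1/9`.  When every member face inside the
target misses at least `m₀` points of `G` (its hyperplane contains at most `|G| − m₀` points), the weight is
`phi m₀ = max 0 (Φ/(m₀ + 2) − 11/90)` instead: `m₀ = 3: 1/9`, `4: 13/180`, `5: 2/45`, `6: 17/720`, `7: 1/135`, `≥ 8: 0`
(`phiFace_le_of_le`, **`faceSum_insert_le_choose_phi`**), and the coloop point's term is `≥ 1 / (2 · phi m₀ · C(s, 2))`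
(**`level_one_term_ge_of_coloop_phi`**).  On the line geometries this is what makes a single coloop point carry the pair: the faces
inside `Q ∪ {y}` contain at most one point of the long line, so their hyperplanes miss the rest of it.
Paper: proofs/NIGHT-2-g37.md §2.
-/

namespace PercRepro.Shadow

open PercRepro.ThmH PercRepro.PerFlat

variable {α : Type*} [DecidableEq α] {M : Matroid α} [M.Finite] {G : Finset α}

/-- The face weight at the threshold `m₀`. -/
noncomputable def phiM (m₀ : ℕ) : ℚ := max 0 (phiQ 5 / ((m₀ : ℚ) + 2) - 11 / 90)

/-- `phiM` is nonnegative. -/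
theorem phiM_nonneg (m₀ : ℕ) : 0 ≤ phiM m₀ := le_max_left _ _

/-- **A thin member missing at least `m₀` points of `G` has `phiFace ≤ phiM m₀`.** -/
theorem phiFace_le_of_le (hG : G ∈ flatsQ M (5 + 1)) (hd : (gr M \ G).card = 2) {B : Finset α}
    (hB : B ∈ thinMembers M 5 G) {m₀ : ℕ} (hm : m₀ ≤ (G \ clF M B).card) : phiFace M B ≤ phiM m₀ := by
  unfold phiFace phiM
  rw [req_eq_of_thin hG hB, hd]
  apply max_le_max (le_refl _)
  apply sub_le_sub_right
  have hm' : (m₀ : ℚ) ≤ ((G \ clF M B).card : ℚ) := by exact_mod_cast hm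
  have hpos : (0 : ℚ) < phiQ 5 := phiQ_pos 5
  push_cast
  apply div_le_div_of_nonneg_left hpos.le (by positivity)
  linarith

/-- **The face sum of a coloop target with the true weight**: `≤ 2 · phiM m₀ · C(s, 2)` when every member face inside the
target misses at least `m₀` points of `G`. -/
theorem faceSum_insert_le_choose_phi (hG : G ∈ flatsQ M (5 + 1)) (hd : (gr M \ G).card = 2)
    (hk : kColoops M G = 1) {B : Finset α} (hB : B ∈ thinMembers M 5 G)
    (hnP : ¬ bigP M G B) {z : α} (hz : z ∈ G \ clF M B) {y : α} (hy : y ∈ G \ insert z B)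
    (hr : rkN M ((G \ insert z B).erase y) ≤ 3) {m₀ : ℕ}
    (hm : ∀ B' ∈ thinMembers M 5 G, ¬ bigP M G B' → B' ⊆ insert y (insert z B) → m₀ ≤ (G \ clF M B').card) :
    faceSum M G (insert y (insert z B)) ≤
      2 * phiM m₀ * (((((insert y (insert z B) \ coloops M G) \ clF M ((G \ insert z B).erase y)).card).choose 2 : ℕ) : ℚ) := by
  have hd' : (gr M \ G).card ≤ 5 := by omega
  have hcount := card_thin_faces_le_choose hG hd hk hB hnP hz hy hr
  unfold faceSum
  calc ∑ B' ∈ (thinMembers M 5 G).filter (fun B' => ¬ bigP M G B' ∧ B' ⊆ insert y (insert z B)),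
        phiFace M B' * (((insert y (insert z B) \ coloops M G) \ clF M B').card : ℚ)
      ≤ ∑ B' ∈ (thinMembers M 5 G).filter (fun B' => ¬ bigP M G B' ∧ B' ⊆ insert y (insert z B)), phiM m₀ * 2 := by
        apply Finset.sum_le_sum
        intro B' hB'
        rw [Finset.mem_filter] at hB'
        obtain ⟨hB'thin, hnP', hB'T⟩ := hB'
        have hKB' : coloops M G ⊆ B' := coloops_subset_of_mem_thinMembers hG hd' hB'thin
        have hphi := phiFace_le_of_le hG hd hB'thin (hm B' hB'thin hnP' hB'T)
        have hc : (((insert y (insert z B) \ coloops M G) \ clF M B').card : ℚ) ≤ 2 := by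
          have h6 := card_insert_sdiff_coloops_eq_six hG hd hk hB hnP hz hy
          have h4 := card_sdiff_eq_four_of_not_bigP hG hd hk hB'thin hnP'
          have hsub : B' \ coloops M G ⊆ insert y (insert z B) \ coloops M G :=
            Finset.sdiff_subset_sdiff hB'T (le_refl _)
          have hsub2 : (insert y (insert z B) \ coloops M G) \ clF M B' ⊆
              (insert y (insert z B) \ coloops M G) \ (B' \ coloops M G) := by
            intro e he
            rw [Finset.mem_sdiff] at he ⊢
            refine ⟨he.1, fun h => he.2 ?_⟩
            exact subset_clF_of_subset_gr ((subset_G_of_mem_thinMembers hB'thin).trans (mem_flatsQ.1 hG).1)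
              (Finset.mem_sdiff.1 h).1
          have := Finset.card_le_card hsub2
          rw [Finset.card_sdiff_of_subset hsub, h6, h4] at this
          exact_mod_cast this
        exact mul_le_mul hphi hc (by positivity) (phiM_nonneg _)
    _ = phiM m₀ * 2 * (((thinMembers M 5 G).filter
          (fun B' => ¬ bigP M G B' ∧ B' ⊆ insert y (insert z B))).card : ℚ) := by
        rw [Finset.sum_const, nsmul_eq_mul, mul_comm]
    _ ≤ phiM m₀ * 2 * ((((insert y (insert z B) \ coloops M G) \ clF M ((G \ insert z B).erase y)).card.choose 2 : ℕ) : ℚ) := by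
        apply mul_le_mul_of_nonneg_left _ (mul_nonneg (phiM_nonneg _) (by norm_num))
        exact_mod_cast hcount
    _ = 2 * phiM m₀ * ((((insert y (insert z B) \ coloops M G) \ clF M ((G \ insert z B).erase y)).card.choose 2 : ℕ) : ℚ) := by
        ring

/-- **The level-1 term of a coloop point with the true weight**: `≥ 1 / (2 · phiM m₀ · C(s, 2))`. -/
theorem level_one_term_ge_of_coloop_phi (hG : G ∈ flatsQ M (5 + 1)) (hd : (gr M \ G).card = 2)
    (hk : kColoops M G = 1) (hs : ∀ e ∈ gr M, ∀ f ∈ gr M, e ≠ f → rkN M {e, f} = 2)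
    (hl : ∀ e ∈ gr M, M.Indep {e}) {B : Finset α}
    (hB : B ∈ thinMembers M 5 G) (hnP : ¬ bigP M G B) {z : α} (hz : z ∈ G \ clF M B)
    (hl0 : loss M 5 G B z ≠ 0) {y : α} (hy : y ∈ G \ insert z B)
    (hr : rkN M ((G \ insert z B).erase y) ≤ 3) {m₀ : ℕ}
    (hm : ∀ B' ∈ thinMembers M 5 G, ¬ bigP M G B' → B' ⊆ insert y (insert z B) → m₀ ≤ (G \ clF M B').card) :
    1 / (2 * phiM m₀ * (((((insert y (insert z B) \ coloops M G) \ clF M ((G \ insert z B).erase y)).card).choose 2 : ℕ) : ℚ)) ≤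
      vCap M G (insert y (insert z B)) / faceSum M G (insert y (insert z B)) := by
  have hT : insert y (insert z B) ∈ tgtSets M 5 G B z :=
    level_one_targets_subset hG hB hz (Finset.mem_image.2 ⟨y, hy, rfl⟩)
  have hpos := faceSum_pos_of_mem_tgtSets hG hd hk hB hnP hz hl0 hT
  have hle := faceSum_insert_le_choose_phi hG hd hk hB hnP hz hy hr hm
  rw [vCap_insert_eq_one_of_rkN_erase_le_three hG hd hk hs hl hB hnP hr]
  have hcpos : 0 < 2 * phiM m₀ *
      ((((insert y (insert z B) \ coloops M G) \ clF M ((G \ insert z B).erase y)).card.choose 2 : ℕ) : ℚ) :=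
    lt_of_lt_of_le hpos hle
  rw [div_le_div_iff₀ hcpos hpos]
  linarith

end PercRepro.Shadow
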